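import Literature.Computability.QuantumComplexity.PPPostBQPCore
import HarnessLib

/-!
# `PP ⊆ PostBQP`, VI: the quantum core — amplitudes and Born weights of the sign patterns

Topic `Literature/Computability/QuantumComplexity`; sixth file of the series proving Aaronson's
`PP ⊆ PostBQP` (Proc. R. Soc. A 461 (2005), Thm. 4; plan in `PPPostBQPScales.lean`), continuing
`PPPostBQPCore.lean` (the family `Core.family`: Hadamards on the coins, the compiled clean block
computing the block bits, Hadamards on the body wires and on the result zone). Here the output
state is computed ("apply Hadamard gates to all qubits in the first register and postselect on
that register being `|0⟩^{⊗n}`. This produces the state `((2^n - s)|0⟩ + s|1⟩)/√…`" — in the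
present variant, block by block and with the signs of the product test):

* `runOn_circ_apply` — **the amplitude of a label `y`** is
  `Σ_r (1/√2)^ρ · ⟨y| H_{S₂} |σ(x, r)⟩`, summed over the coin strings `r` (`S₂` the wires of the
  final Hadamard layer, `σ` the classical stage of file V);
* `yOf s` — for a sign pattern `s ∈ {0,1}^K`, the label reading `s` on the sign wires, `0` on the
  body wires, the indicator of the `true`-code wires of the first `K` cells on the result zone, and
  the (coin-independent) classical values elsewhere; `InEvent s y` — the event "body wires `0`,
  result zone as above, sign wires `s`";
* `hLayer_yOf_sigma` — `⟨yOf s| H_{S₂} |σ(x,r)⟩ = [signs(r) = s] · (1/√2)^{|S₂|} · Π_j (-1)^{q_j(r)}`,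
  `q(r)` the block bits; hence (`runOn_circ_yOf`, with the factorisation `sum_prod_sgn_qbits` of
  file III) **the amplitude of `yOf s` is `(1/√2)^{ρ+|S₂|} · Π_{j<K} blockGap x j s_j`**;
* `runOn_circ_eq_zero_of_inEvent` — every other label of the event has amplitude `0`, so
  (`born_inEvent`) **the Born weight of the event of the constant pattern `b` is
  `2^{-(ρ+|S₂|)} · plusW` (`b = 0`) resp. `· minusW` (`b = 1`)** — the two weights compared by the
  product test (`PPPostBQPBlocks.lean`).

## References

* S. Aaronson, *Quantum computing, postselection, and probabilistic polynomial-time*, Proc. R.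
  Soc. A 461 (2005) 3473–3482, arXiv:quant-ph/0412187: Thm. 4 and its proof.
* M. A. Nielsen, I. L. Chuang, *Quantum Computation and Quantum Information*, CUP 2010, §1.4.4
  eq. (1.50) (`H^{⊗k}` as a character sum), §2.2.5 (Born rule).
-/

noncomputable section

namespace Literature.Computability.QuantumComplexity

namespace PPPostBQP

open Complexity Cryptography RevSim RevClean CWrap _root_.Computability Matrix Finset

namespace Core

variable {Q : Core} (x : List Bool)

/-! ### The first Hadamard layer as a sum over coin strings -/

/-- The coins read off a label. [folklore] -/
def coinsOf (z : QReg (x.length + Q.anc x.length)) : Fin (Q.rho x.length) → Bool :=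
  fun j => z (Q.wire x.length (x.length + j))

/-- The coin wire `j`, as a valid index. [folklore] -/
theorem val_coinWire (j : Fin (Q.rho x.length)) : (Q.wire x.length (x.length + j) : ℕ) = x.length + j :=
  Q.val_wire (Q.coin_lt j.isLt)

/-- Membership in the coin wires, by value. [folklore] -/
theorem mem_coinWires_iff (q : Fin (x.length + Q.anc x.length)) :
    q ∈ Q.coinWires x.length ↔ x.length ≤ (q : ℕ) ∧ (q : ℕ) < x.length + Q.rho x.length := by
  simp only [coinWires, List.mem_map, List.mem_range]
  constructor
  · rintro ⟨j, hj, rfl⟩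
    rw [Q.val_wire (Q.coin_lt hj)]; omega
  · rintro ⟨h1, h2⟩
    exact ⟨q - x.length, by omega, Fin.ext (by rw [Q.val_wire (Q.coin_lt (by omega))]; omega)⟩

/-- `ins x r` reads `x` on the input wires, `r` on the coin wires, `0` elsewhere. [folklore] -/
theorem ins_apply (r : Fin (Q.rho x.length) → Bool) (q : Fin (x.length + Q.anc x.length)) :
    ins x r q = if h : (q : ℕ) < x.length then x.get ⟨q, h⟩
      else if h' : (q : ℕ) < x.length + Q.rho x.length then r ⟨q - x.length, by omega⟩ else false := rfl

/-- `coinsOf (ins x r) = r`. [folklore] -/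
theorem coinsOf_ins (r : Fin (Q.rho x.length) → Bool) : coinsOf x (ins x r) = r := by
  funext j
  unfold coinsOf
  rw [ins_apply]
  have hv := val_coinWire x j
  rw [dif_neg (by rw [hv]; omega), dif_pos (by rw [hv]; omega)]
  congr 1; ext; simp only [hv]; omega

/-- The coin wire through a label index in the coin range. [folklore] -/
theorem wire_add_sub (q : Fin (x.length + Q.anc x.length)) (h1 : x.length ≤ (q : ℕ))
    (h2 : (q : ℕ) < x.length + Q.rho x.length) : Q.wire x.length (x.length + ((q : ℕ) - x.length)) = q := by
  ext; rw [Q.val_wire (Q.coin_lt (by omega))]; omega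

/-- A label is of the form `ins x r` iff it agrees with the padded input off the coin wires, and
then `r` are its coins. [folklore] -/
theorem ins_eq_iff (r : Fin (Q.rho x.length) → Bool) (z : QReg (x.length + Q.anc x.length)) :
    ins x r = z ↔ (∀ q, q ∉ Q.coinWires x.length → z q = padInput x.get (Q.anc x.length) q) ∧ r = coinsOf x z := by
  constructor
  · rintro rfl
    refine ⟨fun q hq => ?_, (coinsOf_ins x r).symm⟩
    rw [mem_coinWires_iff] at hq
    rw [ins_apply, ← liftW_val (padInput x.get (Q.anc x.length)) q, liftW_padInput_get]
    unfold strW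
    by_cases h : (q : ℕ) < x.length
    · rw [dif_pos h, List.getD_eq_getElem _ _ h]; rfl
    · rw [dif_neg h, dif_neg (fun h' => hq ⟨Nat.not_lt.1 h, h'⟩), List.getD_eq_default _ _ (Nat.not_lt.1 h)]
  · rintro ⟨hagree, rfl⟩
    funext q
    rw [ins_apply]
    by_cases h : (q : ℕ) < x.length
    · rw [dif_pos h, hagree q (fun hq => by rw [mem_coinWires_iff] at hq; omega),
        ← liftW_val (padInput x.get (Q.anc x.length)) q, liftW_padInput_get]
      unfold strW; rw [List.getD_eq_getElem _ _ h]; rfl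
    · rw [dif_neg h]
      by_cases h' : (q : ℕ) < x.length + Q.rho x.length
      · rw [dif_pos h']
        show z (Q.wire x.length (x.length + ((q : ℕ) - x.length))) = z q
        rw [wire_add_sub x q (Nat.not_lt.1 h) h']
      · rw [dif_neg h', hagree q (fun hq => by rw [mem_coinWires_iff] at hq; omega),
          ← liftW_val (padInput x.get (Q.anc x.length)) q, liftW_padInput_get]
        unfold strW; rw [List.getD_eq_default _ _ (by omega)]

/-- **The first Hadamard layer prepares the uniform superposition over the coin strings.**
[cite: NielsenChuang2010, §1.4.4 eq. (1.50)] -/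
theorem stage1_eq_sum :
    (⟨hGates (Q.coinWires x.length)⟩ : QCircuit cliffordT (x.length + Q.anc x.length)).toMatrix 0 *ᵥ
        basisState (padInput x.get (Q.anc x.length)) =
      ∑ r : Fin (Q.rho x.length) → Bool, (invSqrt2 ^ Q.rho x.length) • basisState (ins x r) := by
  rw [hGates, hadamards_mulVec_basisState _ (Q.coinWires_nodup x.length) _ (fun q hq => by
    rw [mem_coinWires_iff] at hq
    rw [← liftW_val (padInput x.get (Q.anc x.length)) q, liftW_padInput_get]
    exact List.getD_eq_default _ _ hq.1)]
  funext z
  rw [Finset.sum_apply]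
  simp only [Pi.smul_apply, basisState_apply, smul_eq_mul, mul_ite, mul_one, mul_zero]
  have hlen : (Q.coinWires x.length).length = Q.rho x.length := by simp [coinWires]
  rw [hlen]
  simp_rw [eq_comm (a := z), ins_eq_iff x]
  by_cases hag : ∀ q, q ∉ Q.coinWires x.length → z q = padInput x.get (Q.anc x.length) q
  · rw [if_pos hag, Finset.sum_eq_single (coinsOf x z) (fun r _ hr => if_neg fun h => hr h.2)
      (fun h => absurd (Finset.mem_univ _) h), if_pos ⟨hag, rfl⟩]
  · rw [if_neg hag]
    exact (Finset.sum_eq_zero fun r _ => if_neg fun h => hag h.1).symm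

/-! ### The amplitude of a label -/

/-- The wires of the final Hadamard layer, as a set. [folklore] -/
def S2 (Q : Core) (n : ℕ) : Finset (Fin (n + Q.anc n)) := (Q.h2Wires n).toFinset

/-- **The amplitude of a label** after the whole circuit: a sum over the coin strings of the
entries of the final Hadamard layer at the classical labels. [cite: NielsenChuang2010, §2.2.5] -/
theorem runOn_circ_apply (y : QReg (x.length + Q.anc x.length)) :
    (Q.circ x.length).runOn 0 (basisState (padInput x.get (Q.anc x.length))) y =
      ∑ r : Fin (Q.rho x.length) → Bool, invSqrt2 ^ Q.rho x.length * BGK.hLayerMatrix (S2 Q x.length) y (sigma x r) := by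
  have hc : Q.circ x.length = ((⟨hGates (Q.coinWires x.length)⟩ : QCircuit cliffordT _).append
      ((⟨revCompile (Q.clamp x.length)⟩ : QCircuit cliffordT _).append ⟨hGates (Q.h2Wires x.length)⟩)) := rfl
  rw [QCircuit.runOn, hc, QCircuit.toMatrix_append, QCircuit.toMatrix_append, ← Matrix.mulVec_mulVec,
    stage1_eq_sum, Matrix.mulVec_sum, Finset.sum_apply]
  refine Finset.sum_congr rfl fun r _ => ?_
  rw [Matrix.mulVec_smul, ← Matrix.mulVec_mulVec, revCompile_mulVec_basisState,
    toMatrix_hGates _ _ (Q.h2Wires_nodup x.length), Pi.smul_apply, mulVec_basisState, smul_eq_mul]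
  rfl

/-! ### Geometry of the final layer -/

/-- Membership in the final layer, by value: body wires or result zone. [folklore] -/
theorem mem_S2_iff (q : Fin (x.length + Q.anc x.length)) :
    q ∈ S2 Q x.length ↔ (x.length + Q.K x.length ≤ (q : ℕ) ∧ (q : ℕ) < x.length + Q.rho x.length) ∨
      (Q.resStart x.length ≤ (q : ℕ) ∧ (q : ℕ) < Q.resStart x.length + Q.resLen x.length) := by
  have hb : ∀ j, j < Q.bods x.length → x.length + Q.K x.length + j < x.length + Q.anc x.length := fun j hj => by
    have := Q.coin_lt (n := x.length) (j := Q.K x.length + j) (by unfold rho; omega); omega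
  simp only [S2, List.mem_toFinset, h2Wires, List.mem_append, bodyWires, resWires, List.mem_map, List.mem_range]
  constructor
  · rintro (⟨j, hj, rfl⟩ | ⟨j, hj, rfl⟩)
    · left; rw [Q.val_wire (hb j hj)]; unfold rho; omega
    · right; rw [Q.val_wire (Q.res_lt hj)]; omega
  · rintro (⟨h1, h2⟩ | ⟨h1, h2⟩)
    · left; refine ⟨q - (x.length + Q.K x.length), by unfold rho at h2; omega, Fin.ext ?_⟩
      rw [Q.val_wire (hb _ (by unfold rho at h2; omega))]; omega
    · right; refine ⟨q - Q.resStart x.length, by omega, Fin.ext ?_⟩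
      rw [Q.val_wire (Q.res_lt (by omega))]; omega

/-- A `true`-code wire of a cell `j < K` (the wires read `1` by the post-selection pattern). [folklore] -/
def IsT (Q : Core) (n : ℕ) (q : Fin (n + Q.anc n)) : Prop := ∃ j < Q.K n, (q : ℕ) = resW Q.e Q.M (Q.nT n) j (symTrue Q.M)

/-- `IsT` is decidable (a bounded existential over `j < K`). [folklore] -/
instance (Q : Core) (n : ℕ) (q : Fin (n + Q.anc n)) : Decidable (IsT Q n q) := by unfold IsT; infer_instance

/-- The `true`-code wire of cell `j`. [folklore] -/
def tWire (Q : Core) (n j : ℕ) : Fin (n + Q.anc n) := Q.wire n (resW Q.e Q.M (Q.nT n) j (symTrue Q.M))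

/-- The `true`-code wire of a cell `j < K` lies in the result zone, hence in `S₂`. [folklore] -/
theorem resW_lt_of_lt {j : ℕ} (hj : j < Q.K x.length) (a : OSym Q.M) :
    Q.resStart x.length ≤ resW Q.e Q.M (Q.nT x.length) j a ∧
      resW Q.e Q.M (Q.nT x.length) j a < Q.resStart x.length + Q.resLen x.length := by
  unfold resStart resLen resW
  have h1 : (eA Q.M a : ℕ) < A₁ Q.M := (eA Q.M a).isLt
  constructor
  · omega
  · have : j * A₁ Q.M + A₁ Q.M ≤ Q.K x.length * A₁ Q.M := by
      rw [← Nat.succ_mul]; exact Nat.mul_le_mul_right _ hj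
    omega

/-- Value of `tWire`. [folklore] -/
theorem val_tWire {j : ℕ} (hj : j < Q.K x.length) :
    (tWire Q x.length j : ℕ) = resW Q.e Q.M (Q.nT x.length) j (symTrue Q.M) :=
  Q.val_wire (by
    rw [Q.n_add_anc]
    have := resW_lt_of_lt x hj (symTrue Q.M)
    have := Q.resStart_add_resLen_le x.length
    omega)

/-- `tWire j ∈ S₂` for `j < K`. [folklore] -/
theorem tWire_mem_S2 {j : ℕ} (hj : j < Q.K x.length) : tWire Q x.length j ∈ S2 Q x.length := by
  rw [mem_S2_iff]; right; rw [val_tWire x hj]; exact resW_lt_of_lt x hj _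

/-- The pattern wires of `S₂` are exactly the `tWire j`, `j < K`. [folklore] -/
theorem filter_isT_eq :
    (S2 Q x.length).filter (IsT Q x.length) = (Finset.range (Q.K x.length)).image (tWire Q x.length) := by
  ext q
  simp only [Finset.mem_filter, Finset.mem_image, Finset.mem_range, IsT]
  constructor
  · rintro ⟨-, j, hj, hq⟩
    exact ⟨j, hj, Fin.ext (by rw [val_tWire x hj, hq])⟩
  · rintro ⟨j, hj, rfl⟩
    exact ⟨tWire_mem_S2 x hj, j, hj, val_tWire x hj⟩

/-- `tWire` is injective on `j < K`. [folklore] -/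
theorem tWire_injOn : Set.InjOn (tWire Q x.length) (Finset.range (Q.K x.length) : Set ℕ) := by
  intro a ha b hb h
  have h' := congrArg Fin.val h
  rw [val_tWire x (Finset.mem_range.1 ha), val_tWire x (Finset.mem_range.1 hb)] at h'
  exact (resW_inj h').1

/-! ### Classical values off the final layer do not depend on the bodies -/

/-- The read-out of a cell beyond the output word is a constant. [folklore] -/
theorem outBit_of_length_le {l' : List Bool} {j : ℕ} (hj : l'.length ≤ j) (a : OSym Q.M) :
    outBit Q.M l' j a = decide (none = a) := by
  unfold outBit
  rw [cellVal_haltList_of_le hj]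

/-- **Off the result zone, the read-out of two output words of length `K` agree.** [folklore] -/
theorem readOut_eq_of_not_mem {l₁ l₂ : List Bool} (h₁ : l₁.length = Q.K x.length) (h₂ : l₂.length = Q.K x.length)
    {i : ℕ} (hi : ¬ (Q.resStart x.length ≤ i ∧ i < Q.resStart x.length + Q.resLen x.length)) :
    readOut Q.e Q.M (Q.nT x.length) l₁ i = readOut Q.e Q.M (Q.nT x.length) l₂ i := by
  unfold readOut
  split_ifs with h
  · have hA := one_le_A₁ (M := Q.M)
    have hcell : Q.K x.length ≤ (i - NN Q.e Q.M (Q.nT x.length)) / A₁ Q.M := by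
      by_contra hc
      apply hi
      unfold resStart resLen
      have := Nat.lt_of_div_lt_div (a := i - NN Q.e Q.M (Q.nT x.length)) (b := Q.K x.length * A₁ Q.M) (c := A₁ Q.M)
        (by rw [Nat.mul_div_cancel _ hA]; omega)
      omega
    rw [outBit_of_length_le (by omega), outBit_of_length_le (by omega)]
  · rfl

/-- The sign coins of a coin string. [folklore] -/
def signsOf (r : Fin (Q.rho x.length) → Bool) : Fin (Q.K x.length) → Bool := fun j => r (Fin.castAdd _ j)

/-- The coin string with signs `s` and all bodies `0`. [folklore] -/
def r0 (s : Fin (Q.K x.length) → Bool) : Fin (Q.rho x.length) → Bool := Fin.append s fun _ => false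

/-- `signsOf (Fin.append s Y) = s`. [folklore] -/
@[simp] theorem signsOf_append (s : Fin (Q.K x.length) → Bool) (Y : Fin (Q.bods x.length) → Bool) :
    signsOf x (Fin.append s Y) = s := by
  funext j; simp [signsOf]

/-- `signsOf (r0 s) = s`. [folklore] -/
@[simp] theorem signsOf_r0 (s : Fin (Q.K x.length) → Bool) : signsOf x (r0 x s) = s := by
  funext j; simp [signsOf, r0]

/-- The sign wire `j`. [folklore] -/
def sWire (j : Fin (Q.K x.length)) : Fin (x.length + Q.anc x.length) :=
  ⟨x.length + j, by have := Q.coin_lt (n := x.length) (j := j) (by unfold rho; omega); omega⟩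

/-- Value of the sign wire. [folklore] -/
@[simp] theorem val_sWire (j : Fin (Q.K x.length)) : (sWire x j : ℕ) = x.length + j := rfl

/-- Sign wires are not in `S₂`. [folklore] -/
theorem sWire_not_mem_S2 (j : Fin (Q.K x.length)) : sWire x j ∉ S2 Q x.length := by
  rw [mem_S2_iff, not_or, val_sWire]
  have := Q.nT_le_resStart x.length
  unfold nT n0 rho at this
  constructor <;> omega

/-- A data wire `q < n0` reads bit `q` of `x ++ r`; on a sign wire this is the sign coin. [folklore] -/
theorem sigma_signWire (r : Fin (Q.rho x.length) → Bool) (j : Fin (Q.K x.length))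
    (q : Fin (x.length + Q.anc x.length)) (hq : (q : ℕ) = x.length + j) : sigma x r q = signsOf x r j := by
  rw [sigma_apply_of_lt x r (by rw [hq]; unfold n0 rho; omega), hq, List.getD_append_right _ _ _ _ (by omega),
    Nat.add_sub_cancel_left, List.getD_eq_getElem _ _ (by simp; unfold rho; omega), List.getElem_ofFn]
  rfl

/-- **Two coin strings with the same signs give the same classical label off `S₂`.** [folklore] -/
theorem sigma_eq_of_not_mem_S2 {r r' : Fin (Q.rho x.length) → Bool} (hs : signsOf x r = signsOf x r')
    {q : Fin (x.length + Q.anc x.length)} (hq : q ∉ S2 Q x.length) : sigma x r q = sigma x r' q := by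
  rw [mem_S2_iff, not_or] at hq
  by_cases h0 : (q : ℕ) < Q.n0 x.length
  · rw [sigma_apply_of_lt x r h0, sigma_apply_of_lt x r' h0]
    by_cases h1 : (q : ℕ) < x.length
    · rw [List.getD_append _ _ _ _ h1, List.getD_append _ _ _ _ h1]
    · have hK : (q : ℕ) - x.length < Q.K x.length := by unfold n0 at h0; omega
      have e1 := sigma_signWire x r ⟨_, hK⟩ q (by simp; omega)
      have e2 := sigma_signWire x r' ⟨_, hK⟩ q (by simp; omega)
      rw [sigma_apply_of_lt x r h0] at e1; rw [sigma_apply_of_lt x r' h0] at e2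
      rw [e1, e2, hs]
  · rw [sigma_apply, sigma_apply, if_neg h0, if_neg h0]
    exact readOut_eq_of_not_mem x (length_outWord x r) (length_outWord x r') hq.2

/-! ### The labels of the events and the entries of the final layer -/

/-- **The label of the sign pattern `s`**: the post-selection pattern on `S₂` (indicator of the
`true`-code wires of the first `K` cells; in particular `0` on the body wires) and the classical
values of the zero-body coin string elsewhere. [cite: Aaronson2005, Thm. 4 (proof: postselect on |0…0⟩)] -/
def yOf (s : Fin (Q.K x.length) → Bool) : QReg (x.length + Q.anc x.length) := fun q =>
  if q ∈ S2 Q x.length then decide (IsT Q x.length q) else sigma x (r0 x s) q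

/-- **The event of the sign pattern `s`**: pattern on `S₂`, signs `s` on the sign wires. [folklore] -/
def InEvent (s : Fin (Q.K x.length) → Bool) (y : QReg (x.length + Q.anc x.length)) : Prop :=
  (∀ q ∈ S2 Q x.length, y q = decide (IsT Q x.length q)) ∧
    ∀ (j : Fin (Q.K x.length)) (q : Fin (x.length + Q.anc x.length)), (q : ℕ) = x.length + j → y q = s j

/-- `yOf s` lies in its event. [folklore] -/
theorem inEvent_yOf (s : Fin (Q.K x.length) → Bool) : InEvent x s (yOf x s) := by
  refine ⟨fun q hq => by simp [yOf, hq], fun j q hq => ?_⟩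
  have hnot : q ∉ S2 Q x.length := by
    rw [mem_S2_iff, not_or, hq]; have := Q.nT_le_resStart x.length; unfold nT n0 rho at this; constructor <;> omega
  unfold yOf
  rw [if_neg hnot, sigma_signWire x _ j q hq, signsOf_r0]

/-- `hCoef` through the integer sign: `⟨a|H|b⟩ = (1/√2) · (a ? (-1)^b : 1)`. [cite: NielsenChuang2010, §4.2] -/
theorem hCoef_eq (a b : Bool) : BGK.hCoef a b = invSqrt2 * (if a then ((sgn b : ℤ) : ℂ) else 1) := by
  cases a <;> cases b <;> simp [BGK.hCoef, sgn]

/-- Signs of the bits of a list, as a product over positions. [folklore] -/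
theorem prod_range_sgn_getD : ∀ l : List Bool,
    ∏ j ∈ Finset.range l.length, ((sgn (l.getD j false) : ℤ) : ℂ) = (((l.map sgn).prod : ℤ) : ℂ)
  | [] => by simp
  | b :: l => by
    rw [List.length_cons, Finset.prod_range_succ', List.map_cons, List.prod_cons, Int.cast_mul, mul_comm]
    simp only [List.getD_cons_succ, List.getD_cons_zero]
    rw [prod_range_sgn_getD l]

/-- **The entry of the final Hadamard layer between the pattern label and a classical label**:
zero unless the signs match, and then `(1/√2)^{|S₂|}` times the product of the signs of the block
bits. [cite: NielsenChuang2010, §1.4.4 eq. (1.50)] -/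
theorem hLayer_yOf_sigma (s : Fin (Q.K x.length) → Bool) (r : Fin (Q.rho x.length) → Bool) :
    BGK.hLayerMatrix (S2 Q x.length) (yOf x s) (sigma x r) =
      if signsOf x r = s then invSqrt2 ^ (S2 Q x.length).card * ((((outWord x r).map sgn).prod : ℤ) : ℂ) else 0 := by
  rw [BGK.hLayerMatrix_apply]
  by_cases hs : signsOf x r = s
  · -- agreement off `S₂`
    have hag : ∀ q, q ∉ S2 Q x.length → yOf x s q = sigma x r q := fun q hq => by
      simp only [yOf, hq, if_false]
      exact sigma_eq_of_not_mem_S2 x (by rw [signsOf_r0, hs]) hq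
    rw [if_pos hag, if_pos hs]
    -- the product over `S₂`
    have hy : ∀ q ∈ S2 Q x.length, yOf x s q = decide (IsT Q x.length q) := fun q hq => by simp [yOf, hq]
    rw [Finset.prod_congr rfl fun q hq => by rw [hy q hq, hCoef_eq], Finset.prod_mul_distrib, Finset.prod_const]
    congr 1
    simp only [decide_eq_true_eq]
    rw [← Finset.prod_filter, filter_isT_eq, Finset.prod_image (tWire_injOn x), ← length_outWord x r,
      ← prod_range_sgn_getD]
    refine Finset.prod_congr rfl fun j hj => ?_
    have hj' := Finset.mem_range.1 hj
    rw [sigma_resW_symTrue x r (by rwa [length_outWord] at hj') _ (val_tWire x (by rwa [length_outWord] at hj')),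
      List.getD_eq_getElem _ _ hj']
  · rw [if_neg hs, if_neg]
    intro hag
    apply hs
    funext j
    have h := hag (sWire x j) (sWire_not_mem_S2 x j)
    rw [(inEvent_yOf x s).2 j _ (val_sWire x j), sigma_signWire x r j _ (val_sWire x j)] at h
    exact h.symm

/-! ### The amplitude of the pattern labels -/

/-- Sums over coin strings split into signs and bodies. [folklore] -/
theorem sum_rho_eq (F : (Fin (Q.rho x.length) → Bool) → ℂ) :
    ∑ r : Fin (Q.rho x.length) → Bool, F r =
      ∑ s : Fin (Q.K x.length) → Bool, ∑ Y : Fin (Q.bods x.length) → Bool, F (Fin.append s Y) :=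
  sum_fin_add _ _ F

/-- Transport of a sum over `{0,1}^a` along `a = b`, read through `List.ofFn`. [folklore] -/
theorem sum_fin_congr {α : Type*} [AddCommMonoid α] {a b : ℕ} (h : a = b) (F : List Bool → α) :
    ∑ Y : Fin a → Bool, F (List.ofFn Y) = ∑ Y : Fin b → Bool, F (List.ofFn Y) := by
  subst h; rfl

/-- The output word on a split coin string. [folklore] -/
theorem outWord_append (s : Fin (Q.K x.length) → Bool) (Y : Fin (Q.bods x.length) → Bool) :
    outWord x (Fin.append s Y) = qbits Q.R Q.p x 0 (List.ofFn s) (List.ofFn Y) := by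
  rw [outWord_eq, List.ofFn_fin_append, List.take_left' (List.length_ofFn), List.drop_left' (List.length_ofFn)]

/-- **The amplitude of the pattern label `yOf s`** is `(1/√2)^{ρ+|S₂|} Π_{j<K} blockGap x j s_j`.
[cite: Aaronson2005, Thm. 4 (proof)] -/
theorem runOn_circ_yOf (s : Fin (Q.K x.length) → Bool) :
    (Q.circ x.length).runOn 0 (basisState (padInput x.get (Q.anc x.length))) (yOf x s) =
      invSqrt2 ^ Q.rho x.length * invSqrt2 ^ (S2 Q x.length).card *
        (((∏ j ∈ Finset.range (Q.K x.length), blockGap Q.R Q.p x j ((List.ofFn s).getD j false) : ℤ) : ℂ)) := by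
  rw [runOn_circ_apply, ← Finset.mul_sum, sum_rho_eq, mul_assoc]
  congr 1
  simp_rw [hLayer_yOf_sigma, signsOf_append]
  rw [Finset.sum_eq_single s (fun s' _ hs' => by simp [hs']) (fun h => absurd (Finset.mem_univ s) h)]
  simp only [if_true, ← Finset.mul_sum, outWord_append]
  congr 1
  rw [← Int.cast_sum]
  congr 1
  have h := sum_prod_sgn_qbits (R := Q.R) (p := Q.p) x (List.ofFn s) 0
  rw [sum_fin_congr (show Q.bods x.length = bodiesLen (bodyLen Q.p x.length) (List.ofFn s).length by
    rw [List.length_ofFn]; rfl) fun l => (((qbits Q.R Q.p x 0 (List.ofFn s) l).map sgn).prod : ℤ), h]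
  simp only [Nat.zero_add, List.length_ofFn]

/-- **Labels of the event other than `yOf s` have amplitude `0`.** [folklore] -/
theorem runOn_circ_eq_zero_of_inEvent {s : Fin (Q.K x.length) → Bool} {y : QReg (x.length + Q.anc x.length)}
    (hy : InEvent x s y) (hne : y ≠ yOf x s) :
    (Q.circ x.length).runOn 0 (basisState (padInput x.get (Q.anc x.length))) y = 0 := by
  rw [runOn_circ_apply]
  refine Finset.sum_eq_zero fun r _ => ?_
  rw [BGK.hLayerMatrix_apply]
  split_ifs with hag
  · exfalso
    apply hne
    -- the signs of `r` are `s`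
    have hs : signsOf x r = s := by
      funext j
      rw [← sigma_signWire x r j _ (val_sWire x j), ← hag _ (sWire_not_mem_S2 x j), hy.2 j _ (val_sWire x j)]
    funext q
    by_cases hq : q ∈ S2 Q x.length
    · rw [hy.1 q hq]; simp [yOf, hq]
    · rw [hag q hq]; simp only [yOf, hq, if_false]
      exact sigma_eq_of_not_mem_S2 x (by rw [hs, signsOf_r0]) hq
  · exact mul_zero _

/-! ### Born weights of the events -/

/-- `InEvent s` is decidable (finitely many wire conditions). [folklore] -/
instance (s : Fin (Q.K x.length) → Bool) : DecidablePred (InEvent x s) := fun _ => by unfold InEvent; infer_instance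

/-- **The Born weight of the event of `s`** is the squared amplitude of `yOf s`. [cite: NielsenChuang2010, §2.2.5] -/
theorem born_inEvent (s : Fin (Q.K x.length) → Bool) :
    ∑ y : QReg (x.length + Q.anc x.length), (if InEvent x s y then
        ‖(Q.circ x.length).runOn 0 (basisState (padInput x.get (Q.anc x.length))) y‖ ^ 2 else 0) =
      ((1 / 2 : ℝ) ^ Q.rho x.length * (1 / 2) ^ (S2 Q x.length).card) *
        ∏ j ∈ Finset.range (Q.K x.length), ((blockGap Q.R Q.p x j ((List.ofFn s).getD j false) : ℤ) : ℝ) ^ 2 := by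
  rw [Finset.sum_eq_single (yOf x s)]
  · rw [if_pos (inEvent_yOf x s), runOn_circ_yOf, norm_mul, norm_mul, mul_pow, mul_pow, norm_invSqrt2_pow_sq,
      norm_invSqrt2_pow_sq, Complex.norm_intCast, sq_abs, Int.cast_prod, Finset.prod_pow]
  · intro y _ hy
    by_cases h : InEvent x s y
    · rw [if_pos h, runOn_circ_eq_zero_of_inEvent x h hy, norm_zero]; simp
    · rw [if_neg h]
  · intro h; exact absurd (Finset.mem_univ _) h

/-- The Born weight of the pattern "all signs `0`": `2^{-(ρ+|S₂|)} · plusW`. [cite: Aaronson2005, Thm. 4 (proof)] -/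
theorem born_inEvent_false :
    ∑ y : QReg (x.length + Q.anc x.length), (if InEvent x (fun _ => false) y then
        ‖(Q.circ x.length).runOn 0 (basisState (padInput x.get (Q.anc x.length))) y‖ ^ 2 else 0) =
      ((1 / 2 : ℝ) ^ Q.rho x.length * (1 / 2) ^ (S2 Q x.length).card) * plusW Q.R Q.p x := by
  rw [born_inEvent]
  congr 1
  unfold plusW Core.K
  exact Finset.prod_congr rfl fun j hj => by
    rw [List.getD_eq_getElem _ _ (by rw [List.length_ofFn]; exact Finset.mem_range.1 hj), List.getElem_ofFn]

/-- The Born weight of the pattern "all signs `1`": `2^{-(ρ+|S₂|)} · minusW`. [cite: Aaronson2005, Thm. 4 (proof)] -/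
theorem born_inEvent_true :
    ∑ y : QReg (x.length + Q.anc x.length), (if InEvent x (fun _ => true) y then
        ‖(Q.circ x.length).runOn 0 (basisState (padInput x.get (Q.anc x.length))) y‖ ^ 2 else 0) =
      ((1 / 2 : ℝ) ^ Q.rho x.length * (1 / 2) ^ (S2 Q x.length).card) * minusW Q.R Q.p x := by
  rw [born_inEvent]
  congr 1
  unfold minusW Core.K
  exact Finset.prod_congr rfl fun j hj => by
    rw [List.getD_eq_getElem _ _ (by rw [List.length_ofFn]; exact Finset.mem_range.1 hj), List.getElem_ofFn]

/-- The common positive factor of the two weights. [folklore] -/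
theorem kappa_pos : 0 < (1 / 2 : ℝ) ^ Q.rho x.length * (1 / 2) ^ (S2 Q x.length).card := by positivity

end Core

end PPPostBQP

end Literature.Computability.QuantumComplexity

end
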